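import Literature.RingTheory.HopfAlgebra.FiniteDualCoalgebraLaws
import Literature.RingTheory.HopfAlgebra.FiniteDualQuotient
import HarnessLib

/-!
# The transpose of an algebra map is a morphism of the dual coalgebras; a subalgebra with projective quotient dualises to a
# coalgebra quotient `B'^* = B^* ⧸ ann(B')`
(Tate, *Finite flat group schemes* (in Cornell–Silverman–Stevens 1997), §(3.8) «The dual Hopf algebra and Cartier duality»,
pp. 144–146: the transposes of the structure maps; «the functor `G ↦ G^D` is an anti-equivalence … exact»; Montgomery, *Hopf algebras
and their actions on rings*, 1.3.5 ∕ 9.1.1–9.1.3)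

Topic `RingTheory/HopfAlgebra`; namespace `Literature.RingTheory.HopfAlgebra`.  THEOREMS ONLY (no definition, no instance, no notation,
no named fact, no `sorry`); imports ★ F1 `FiniteDualCoalgebraLaws` (the dual comultiplication `δ = μ^*` on `W_B := WithConv (Module.Dual R B)`
in hypothesis style: `hev : ev (g ⊗ h) (x ⊗ y) = g x * h y`, `hδ : ev (δ f) (x ⊗ y) = f (x * y)`, `hε : ε f = f 1`) and ★ CD3-lin
`FiniteDualQuotient` (exactness of duals).  Cell `pub/hodgecm-mathlib` (D-0151), FLOOR 0, programme F0P5a (crux item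
stmt-HodgeConjecture-24832; KF8 «duality row», H-CD piece **CD3-co** = the COALGEBRA half of «duality swaps sub-objects and quotients»,
mirror of ★ CD3-lin «the transpose of a coalgebra map is an algebra map; a coideal dualises to a subalgebra») — road- and floor-independent
commutative algebra; changes no count.

SETTING.  `φ : B →ₐ[R] B″` a map of `R`-algebras; its TRANSPOSE is any `T : W_{B″} →ₗ[R] W_B` with `hT : (T f) x = f (φ x)` (§1: exists,
unique — it is `φ^* = Hom(φ, R)` transported to the `WithConv` carriers).  `ev, δ, ε` for `B` and `ev″, δ″, ε″` for `B″` as in ★ F1.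
* §1 `exists_transpose`, `transpose_unique`, `evalTwo_map_transpose` (`ev ((T ⊗ T) t) (x ⊗ y) = ev″ t (φ x ⊗ φ y)`).
* §2 **`dualComul_comp_transpose`** — for `B` finite free: `δ ∘ T = (T ⊗ T) ∘ δ″` (Mathlib's `CoalgHomClass.map_comp_comul` field shape on
  the carriers: «`φ^*` is a COALGEBRA map `B″^* → B^*`» because `φ` is multiplicative), and **`dualCounit_comp_transpose`** — `ε ∘ T = ε″`
  (because `φ 1 = 1`).  [Tate (3.8); Montgomery 9.1.3]
* §3 `transpose_injective_of_surjective` (`φ` onto ⇒ `φ^*` injective); for a SUBALGEBRA `B′ ≤ B` (`φ = B′.val`):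
  **`transpose_val_surjective_of_projective`** — if `B ⧸ B′` is a projective `R`-module, restriction `B^* → B′^*` is ONTO (★ CD3-lin
  `dualMap_subtype_surjective_of_projective`); `transpose_val_eq_zero_iff` — its kernel is the annihilator `ann(B′) = {f | f|_{B′} = 0}`;
  `map_transpose_dualComul_eq_zero_of_transpose_eq_zero` — `ann(B′)` is a COIDEAL for `δ` (`(T ⊗ T)(δ k) = 0` when `T k = 0`, `B′` finite
  free).  Reading: **`B′^* ≅ B^* ⧸ ann(B′)` as coalgebras** — Cartier duality turns the finite free sub-bialgebra `B′ ⊆ B` (a QUOTIENT group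
  scheme `G ↠ G′`) into the quotient `B^* ↠ B′^*` (a closed SUBGROUP scheme `G′^D ⊆ G^D`), exactly as ★ CD3-lin turns Hopf quotients into
  subalgebras.  NOT here: the bundled `Coalgebra` instance on `W_B` (DEF desk, CD1), schemes.

HC_CM is proved only modulo the 7 printed citations until rung 0 closes; this file is generic algebra and changes no count.

## References
* [Tate1997FiniteFlatGroupSchemes] J. Tate, *Finite flat group schemes*, in: Modular Forms and Fermat's Last Theorem (1997), §(3.8)
  pp. 144–146.
* [Montgomery1993Hopf] S. Montgomery, *Hopf algebras and their actions on rings*, CBMS 82 (1993), 1.3.5, 9.1.1–9.1.3.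
-/

set_option autoImplicit false

noncomputable section

open TensorProduct Module WithConv

namespace Literature.RingTheory.HopfAlgebra

universe u v w

/-! ## §1 The transpose `φ^* : B″^* → B^*` on the `WithConv` carriers -/

section Transpose

variable {R : Type u} [CommSemiring R] {B : Type v} [Semiring B] [Algebra R B] {B'' : Type w} [Semiring B''] [Algebra R B'']
  (φ : B →ₐ[R] B'')

/-- **existence of the transpose** `T = φ^*`: `(T f) x = f (φ x)` (Mathlib `LinearMap.dualMap` transported along `WithConv.linearEquiv`).
[cite: Tate1997FiniteFlatGroupSchemes, §(3.8) p. 145] -/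
theorem exists_transpose :
    ∃ T : WithConv (Module.Dual R B'') →ₗ[R] WithConv (Module.Dual R B),
      ∀ (f : WithConv (Module.Dual R B'')) (x : B), (T f) x = f (φ x) :=
  ⟨(WithConv.linearEquiv R (Module.Dual R B)).symm.toLinearMap ∘ₗ φ.toLinearMap.dualMap ∘ₗ
      (WithConv.linearEquiv R (Module.Dual R B'')).toLinearMap,
    fun f x => by simp⟩

variable {φ} {T T' : WithConv (Module.Dual R B'') →ₗ[R] WithConv (Module.Dual R B)}

/-- the transpose is unique. [cite: Tate1997FiniteFlatGroupSchemes, §(3.8) p. 145] -/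
theorem transpose_unique (hT : ∀ (f : WithConv (Module.Dual R B'')) (x : B), (T f) x = f (φ x))
    (hT' : ∀ (f : WithConv (Module.Dual R B'')) (x : B), (T' f) x = f (φ x)) : T = T' :=
  LinearMap.ext fun f => WithConv.ext (LinearMap.ext fun x => by rw [hT, hT'])

variable {ev : WithConv (Module.Dual R B) ⊗[R] WithConv (Module.Dual R B) →ₗ[R] Module.Dual R (B ⊗[R] B)}
  {ev'' : WithConv (Module.Dual R B'') ⊗[R] WithConv (Module.Dual R B'') →ₗ[R] Module.Dual R (B'' ⊗[R] B'')}

/-- **`ev ((T ⊗ T) t) (x ⊗ y) = ev″ t (φ x ⊗ φ y)`** — the transpose tensor-squared, tested through the evaluation pairings of ★ F1.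
[cite: Tate1997FiniteFlatGroupSchemes, §(3.8) p. 145] -/
theorem evalTwo_map_transpose
    (hev : ∀ (g h : WithConv (Module.Dual R B)) (x y : B), ev (g ⊗ₜ h) (x ⊗ₜ y) = g x * h y)
    (hev'' : ∀ (g h : WithConv (Module.Dual R B'')) (x y : B''), ev'' (g ⊗ₜ h) (x ⊗ₜ y) = g x * h y)
    (hT : ∀ (f : WithConv (Module.Dual R B'')) (x : B), (T f) x = f (φ x))
    (t : WithConv (Module.Dual R B'') ⊗[R] WithConv (Module.Dual R B'')) (x y : B) :
    ev (TensorProduct.map T T t) (x ⊗ₜ y) = ev'' t (φ x ⊗ₜ φ y) := by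
  induction t using TensorProduct.induction_on with
  | zero => simp only [map_zero, LinearMap.zero_apply]
  | tmul g h => rw [TensorProduct.map_tmul, hev, hT, hT, hev'']
  | add s t hs ht => rw [map_add, map_add, LinearMap.add_apply, hs, ht, map_add, LinearMap.add_apply]

/-! ## §2 `φ^*` is a coalgebra map of the dual coalgebras: `δ ∘ φ^* = (φ^* ⊗ φ^*) ∘ δ″`, `ε ∘ φ^* = ε″` -/

variable {δ : WithConv (Module.Dual R B) →ₗ[R] WithConv (Module.Dual R B) ⊗[R] WithConv (Module.Dual R B)}
  {δ'' : WithConv (Module.Dual R B'') →ₗ[R] WithConv (Module.Dual R B'') ⊗[R] WithConv (Module.Dual R B'')}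

/-- **The transpose of an algebra map commutes with the dual comultiplications**: `δ_B ∘ φ^* = (φ^* ⊗ φ^*) ∘ δ_{B″}` for `B` finite free
— `φ^* : B″^* → B^*` is a COALGEBRA map (Mathlib's `CoalgHomClass.map_comp_comul` shape on the carriers), because
`(φ^* f)(x y) = f(φ x · φ y)`.  [cite: Tate1997FiniteFlatGroupSchemes, §(3.8) pp. 145–146] [cite: Montgomery1993Hopf, 9.1.3] -/
theorem dualComul_comp_transpose [Module.Free R B] [Module.Finite R B]
    (hev : ∀ (g h : WithConv (Module.Dual R B)) (x y : B), ev (g ⊗ₜ h) (x ⊗ₜ y) = g x * h y)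
    (hδ : ∀ (f : WithConv (Module.Dual R B)) (x y : B), ev (δ f) (x ⊗ₜ y) = f (x * y))
    (hev'' : ∀ (g h : WithConv (Module.Dual R B'')) (x y : B''), ev'' (g ⊗ₜ h) (x ⊗ₜ y) = g x * h y)
    (hδ'' : ∀ (f : WithConv (Module.Dual R B'')) (x y : B''), ev'' (δ'' f) (x ⊗ₜ y) = f (x * y))
    (hT : ∀ (f : WithConv (Module.Dual R B'')) (x : B), (T f) x = f (φ x)) :
    δ ∘ₗ T = TensorProduct.map T T ∘ₗ δ'' :=
  LinearMap.ext fun f => eq_of_evalTwo_eq hev fun x y => by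
    rw [LinearMap.comp_apply, hδ, hT, map_mul, LinearMap.comp_apply, evalTwo_map_transpose hev hev'' hT, hδ'']

variable {ε : WithConv (Module.Dual R B) →ₗ[R] R} {ε'' : WithConv (Module.Dual R B'') →ₗ[R] R}

/-- **The transpose of an algebra map commutes with the dual counits**: `ε_B ∘ φ^* = ε_{B″}` (`(φ^* f)(1) = f(φ 1) = f 1`; Mathlib's
`CoalgHomClass.counit_comp` shape). [cite: Tate1997FiniteFlatGroupSchemes, §(3.8) pp. 145–146] -/
theorem dualCounit_comp_transpose (hε : ∀ f : WithConv (Module.Dual R B), ε f = f 1)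
    (hε'' : ∀ f : WithConv (Module.Dual R B''), ε'' f = f 1)
    (hT : ∀ (f : WithConv (Module.Dual R B'')) (x : B), (T f) x = f (φ x)) : ε ∘ₗ T = ε'' :=
  LinearMap.ext fun f => by rw [LinearMap.comp_apply, hε, hT, map_one, hε'']

/-! ## §3 Injectivity for surjective `φ`; subalgebras dualise to coalgebra quotients -/

/-- `φ` onto ⇒ `φ^*` injective. [cite: Tate1997FiniteFlatGroupSchemes, §(3.8) p. 146] -/
theorem transpose_injective_of_surjective (hφ : Function.Surjective φ)
    (hT : ∀ (f : WithConv (Module.Dual R B'')) (x : B), (T f) x = f (φ x)) : Function.Injective T := by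
  intro f g h
  apply WithConv.ext
  apply LinearMap.ext
  intro z
  obtain ⟨x, rfl⟩ := hφ z
  have h' := congrArg (fun u : WithConv (Module.Dual R B) => u x) h
  simp only [hT] at h'
  exact h'

/-- If `φ^* k = 0` then `(φ^* ⊗ φ^*) (δ″ k) = 0` (`B` finite free): the kernel of the transpose is a COIDEAL for the dual
comultiplication (formal from `dualComul_comp_transpose`). [cite: Tate1997FiniteFlatGroupSchemes, §(3.8) p. 146] -/
theorem map_transpose_dualComul_eq_zero_of_transpose_eq_zero [Module.Free R B] [Module.Finite R B]
    (hev : ∀ (g h : WithConv (Module.Dual R B)) (x y : B), ev (g ⊗ₜ h) (x ⊗ₜ y) = g x * h y)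
    (hδ : ∀ (f : WithConv (Module.Dual R B)) (x y : B), ev (δ f) (x ⊗ₜ y) = f (x * y))
    (hev'' : ∀ (g h : WithConv (Module.Dual R B'')) (x y : B''), ev'' (g ⊗ₜ h) (x ⊗ₜ y) = g x * h y)
    (hδ'' : ∀ (f : WithConv (Module.Dual R B'')) (x y : B''), ev'' (δ'' f) (x ⊗ₜ y) = f (x * y))
    (hT : ∀ (f : WithConv (Module.Dual R B'')) (x : B), (T f) x = f (φ x))
    {k : WithConv (Module.Dual R B'')} (hk : T k = 0) : TensorProduct.map T T (δ'' k) = 0 := by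
  have h := LinearMap.congr_fun (dualComul_comp_transpose hev hδ hev'' hδ'' hT) k
  rw [LinearMap.comp_apply, LinearMap.comp_apply, hk, map_zero] at h
  exact h.symm

end Transpose

section Subalgebra

variable {R : Type u} [CommRing R] {B : Type v} [CommRing B] [Algebra R B] (B' : Subalgebra R B)
  {T : WithConv (Module.Dual R B) →ₗ[R] WithConv (Module.Dual R B')}

/-- **`φ^* f = 0` iff `f` vanishes on the subalgebra**: the kernel of restriction `B^* → B′^*` is the annihilator `ann(B′)`.
[cite: Tate1997FiniteFlatGroupSchemes, §(3.8) p. 146] -/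
theorem transpose_val_eq_zero_iff (hT : ∀ (f : WithConv (Module.Dual R B)) (x : B'), (T f) x = f (B'.val x))
    (f : WithConv (Module.Dual R B)) :
    T f = 0 ↔ f.ofConv ∈ (Subalgebra.toSubmodule B').dualAnnihilator := by
  rw [Submodule.mem_dualAnnihilator]
  constructor
  · intro h x hx
    have h' := congrArg (fun u : WithConv (Module.Dual R B') => u ⟨x, hx⟩) h
    simp only [hT] at h'
    exact h'
  · intro h
    apply WithConv.ext
    apply LinearMap.ext
    intro x
    rw [hT]
    exact h x x.2

/-- **Restriction `B^* → B′^*` is ONTO when `B ⧸ B′` is a projective `R`-module** (e.g. `B′ ⊆ B` finite free sub-bialgebra of a finite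
free Hopf algebra with free quotient): every functional on `B′` extends to `B` (★ CD3-lin `dualMap_subtype_surjective_of_projective`).
With §2: `B′^* = B^* ⧸ ann(B′)` as COALGEBRAS — the dual of a SUB-object is a QUOTIENT. [cite: Tate1997FiniteFlatGroupSchemes, §(3.8)
p. 146] -/
theorem transpose_val_surjective_of_projective [Module.Projective R (B ⧸ Subalgebra.toSubmodule B')]
    (hT : ∀ (f : WithConv (Module.Dual R B)) (x : B'), (T f) x = f (B'.val x)) : Function.Surjective T := by
  intro g
  obtain ⟨ψ, hψ⟩ := dualMap_subtype_surjective_of_projective (Subalgebra.toSubmodule B') (ofConv g)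
  refine ⟨toConv ψ, ?_⟩
  apply WithConv.ext
  apply LinearMap.ext
  intro x
  rw [hT]
  have h := LinearMap.congr_fun hψ x
  rw [LinearMap.dualMap_apply] at h
  exact h

end Subalgebra

end Literature.RingTheory.HopfAlgebra

end
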